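import Literature.NumberTheory.EllipticCurves.SelmerCorankProofs
import Literature.NumberTheory.EllipticCurves.IwasawaCoinvariantsRankProofs
import Literature.NumberTheory.EllipticCurves.SubgroupSelmer
import Literature.NumberTheory.EllipticCurves.GaloisAction
import HarnessLib

/-!
# The Kummer map `H¹(H, M[p]) → H¹(H, M)` for a `p`-divisible discrete module: onto the `p`-torsion,
# finite kernel, injective where `H` acts trivially
# (helper for crux stmt-BirchSwinnertonDyer-20368 `PrintCf2.SplitBadTwoRankOneOfFacts`; cell `bsd-print-cf2`,
# seat `bsd-line-cf2-p1-w7` g5, file 9 — generic input of the finite-generation half of leaf (ii)_nr)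

GENERIC group cohomology (any topological group `G`, subgroup `H ≤ G`, discrete `G`-module `M`,
prime `p`; the `p`-torsion `M[p] = AddSubgroup.torsionBy M p` carries the restricted action of the
tree's `AddSubgroup.torsionBy.instDistribMulAction`), verbatim the argument of the tree's
`WeierstrassCurve.exists_torsionToPrimaryH1Sub_eq` / `finite_ker_torsionToPrimaryH1Sub`
(`SelmerInftyTorsionFiniteProofs`, for `E[p] ⊂ E[p^∞]`) with the elliptic curve replaced by the
hypotheses it actually uses: `p`-divisibility (`∀ a, ∃ b, p • b = a`), continuity of orbit maps,
`p`-primarity and finiteness of the `M[p^n]`.  The map is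
`ι_H := resH1Hom (id_H) (M[p] ↪ M) : H¹(H, M[p]) → H¹(H, M)`.

* §1 `exists_torsionToH1_eq` — (A) `ι_H` hits every class killed by `p` (Kummer: `p φ = ∂(p b)`,
  `φ − ∂b` is `M[p]`-valued);
* §2 `finite_ker_torsionToH1` — `ker ι_H` is finite: it is the image of `B/pB`, `B = M^H`, under
  `β ↦ [∂ b_β]` (`p b_β = β`), and `B/pB` is finite by the pigeonhole
  `ResKernel.finite_quotient_range_of_finite_ker` over the finite stable pieces `B[p^n] ⊆ M[p^n]`;
* §3 `torsionToH1_injective_of_forall_smul_eq` — if `H` acts TRIVIALLY on `M` then `ι_H` is injective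
  (a kernel class is `[∂b]` with `∂b = 0`); `conjH1_torsionToH1` / `resH1Hom_torsionToH1` — naturality
  of `ι` under conjugation and under restriction along a continuous homomorphism into `H`.

Use (file 10): the `p`-torsion `conj_γ`-invariant classes of the unramified ambient
`unramifiedOutside (ker κ) M p S₀` over a `ℤ_p`-line are finite, hence its canonical `Λ`-dual is
finitely generated (dual Nakayama) — the finite-generation half of leaf (ii)_nr of the S3n′
divisibility road (file 8 `…UnrSelmerTwistDivisibleOfAmbient`).

HONEST FRAMING: algebra only; closes nothing (`--supports`).  No named fact, no definition, no `sorry`.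
No summit statement is proved by this file; BSD is not proved by any of this.

References: Greenberg, LNM 1716 §3 (proof of Lemma 3.1: the Kummer sequence
`0 → B/pB → H¹(N, E[p]) → H¹(N, E[p^∞])[p] → 0`), §5 p. 114; Serre, *Galois Cohomology* I §2.2–2.4.
-/

-- the summit namespace `Summit.BirchSwinnertonDyer.BirchSwinnertonDyer` repeats the problem name by design (D-0017)
set_option linter.dupNamespace false
set_option autoImplicit false

noncomputable section

open scoped Classical
open CategoryTheory Literature.NumberTheory.EllipticCurves Literature.NumberTheory.GaloisRepresentations

namespace Summit.BirchSwinnertonDyer.BirchSwinnertonDyer.Theorems.PrintCf2.KummerTorsion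

universe u

variable {G : Type u} [Group G] [TopologicalSpace G] [IsTopologicalGroup G]
  {M : Type u} [AddCommGroup M] [DistribMulAction G M] [TopologicalSpace M] [DiscreteTopology M]
  (H : Subgroup G) (p : ℕ)

/-! ## §1. (A) The Kummer lift: `H¹(H, M[p]) ↠ H¹(H, M)[p]` -/

/-- **Kummer lift: `ι_H : H¹(H, M[p]) → H¹(H, M)` hits every class killed by `p`**, for `M` a
`p`-divisible discrete module with continuous orbit maps: if `p [φ] = 0` then `p φ = ∂a`, `a = p b`,
and `φ − ∂b` is `M[p]`-valued (Greenberg LNM 1716 §5 p. 114; the tree's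
`exists_torsionToPrimaryH1Sub_eq` for `E[p] ⊂ E[p^∞]`). [cite: GreenbergLNM1716, §5 p. 114] -/
theorem exists_torsionToH1_eq (hdiv : ∀ a : M, ∃ b : M, p • b = a)
    (hcont : ∀ b : M, Continuous fun σ : H ↦ σ • b)
    {x : subgroupH1 H M} (hx : p • x = 0) :
    ∃ y : subgroupH1 H ↥(AddSubgroup.torsionBy M (p : ℤ)),
      resH1Hom (ContinuousMonoidHom.id H) (AddSubgroup.torsionBy M (p : ℤ)).subtype (fun _ _ ↦ rfl) y = x := by
  obtain ⟨φ, rfl⟩ := oneCocycleClass_surjective _ x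
  have h := oneCocycleClass_smul (discreteTopRep H M) (p : ℤ) φ
  conv at h => rhs; rw [Nat.cast_smul_eq_nsmul, hx]
  obtain ⟨a, ha⟩ := (oneCocycleClass_eq_zero_iff _ _).mp h
  have ha' : ∀ σ : H, p • φ.1 σ = σ • a - a := fun σ ↦ by
    rw [← natCast_zsmul]
    exact ha σ
  obtain ⟨b, rfl⟩ := hdiv a
  set φ' := φ - cobCocycle b (hcont b) with hφ'
  have hval : ∀ σ : H, p • φ'.1 σ = 0 := fun σ ↦ by
    change p • (φ.1 σ - (σ • b - b)) = 0
    rw [smul_sub, ha', smul_sub, smul_comm, sub_self]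
  have hmem : ∀ σ : H, φ'.1 σ ∈ AddSubgroup.torsionBy M (p : ℤ) := fun σ ↦
    AddSubgroup.torsionBy.nsmul_iff.mpr (hval σ)
  let χ : contOneCocycles (discreteTopRep H ↥(AddSubgroup.torsionBy M (p : ℤ))) :=
    contOneCocycles.lift (AddSubgroup.torsionBy M (p : ℤ)).subtype (fun _ _ ↦ rfl)
      (fun _ _ h ↦ Subtype.ext h) φ' (fun σ ↦ ⟨_, hmem σ⟩) (fun _ ↦ rfl)
  refine ⟨oneCocycleClass _ χ, ?_⟩
  rw [resH1Hom_id_oneCocycleClass, contOneCocycles.push_lift, hφ', oneCocycleClass_sub,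
    oneCocycleClass_cobCocycle, sub_zero]

/-! ## §2. The kernel of `ι_H` is finite -/

/-- **`ker (H¹(H, M[p]) → H¹(H, M))` is finite** for `M` `p`-primary, `p`-divisible, with finite
`M[p^n]` and continuous orbit maps: a kernel class is `[∂b]` with `p b = β ∈ B = M^H`; two such `b`
differing by `B + M[p]` give the same class, so the kernel is the image of `B/pB`, finite by the
pigeonhole `ResKernel.finite_quotient_range_of_finite_ker` (`ker p|_B = B[p] ⊆ M[p]`, pieces
`B[p^n] ⊆ M[p^n]`).  (Greenberg LNM 1716 §3, proof of Lemma 3.1: `B = E(F_∞)[p^∞]`; the tree's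
`finite_ker_torsionToPrimaryH1Sub`.) [cite: GreenbergLNM1716, §3 Lemma 3.1 (proof)] -/
theorem finite_ker_torsionToH1 [Fact p.Prime] (hdiv : ∀ a : M, ∃ b : M, p • b = a)
    (htors : ∀ m : M, ∃ n : ℕ, p ^ n • m = 0)
    (hfin : ∀ n : ℕ, Finite ↥(AddSubgroup.torsionBy M ((p ^ n : ℕ) : ℤ)))
    (hcont : ∀ b : M, Continuous fun σ : H ↦ σ • b) :
    Set.Finite ((resH1Hom (ContinuousMonoidHom.id H) (AddSubgroup.torsionBy M (p : ℤ)).subtype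
      (fun _ _ ↦ rfl) :
        subgroupH1 H ↥(AddSubgroup.torsionBy M (p : ℤ)) →+ subgroupH1 H M).ker :
      Set (subgroupH1 H ↥(AddSubgroup.torsionBy M (p : ℤ)))) := by
  -- `B = M^H`
  let B : AddSubgroup M := FixedPoints.addSubgroup H M
  -- `B/pB` is finite
  let mulp : B →+ B := DistribSMul.toAddMonoidHom B (p : ℕ)
  have hfinq : Finite (B ⧸ mulp.range) := by
    haveI : Finite mulp.ker := by
      haveI := hfin 1
      refine Finite.of_injective (fun b ↦ (⟨((b : B) : M), ?_⟩ :
        ↥(AddSubgroup.torsionBy M ((p ^ 1 : ℕ) : ℤ)))) ?_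
      · rw [AddSubgroup.torsionBy.nsmul_iff, pow_one]
        have := (AddMonoidHom.mem_ker).mp b.2
        exact congrArg (fun z : B ↦ (z : M)) this
      · intro a b hab
        apply Subtype.ext; apply Subtype.ext
        exact congrArg (fun z : ↥(AddSubgroup.torsionBy M ((p ^ 1 : ℕ) : ℤ)) ↦ (z : M)) hab
    refine (ResKernel.finite_quotient_range_of_finite_ker mulp
      (fun n ↦ AddSubgroup.torsionBy _ ((p ^ n : ℕ) : ℤ)) (fun m n hmn ↦ ?_) (fun b ↦ ?_) (fun n ↦ ?_)
      (fun n b hb ↦ ?_)).1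
    · intro b hb
      rw [AddSubgroup.torsionBy.nsmul_iff] at hb ⊢
      obtain ⟨c, hc⟩ := Nat.pow_dvd_pow p hmn
      rw [hc, Nat.mul_comm (p ^ m) c, ← smul_smul, hb, smul_zero]
    · obtain ⟨n, hn⟩ := htors ((b : B) : M)
      refine ⟨n, ?_⟩
      rw [AddSubgroup.torsionBy.nsmul_iff]
      apply Subtype.ext
      simpa using hn
    · haveI := hfin n
      refine Finite.of_injective (fun b ↦ (⟨((b : B) : M), ?_⟩ :
        ↥(AddSubgroup.torsionBy M ((p ^ n : ℕ) : ℤ)))) ?_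
      · have hb := AddSubgroup.torsionBy.nsmul_iff.mp b.2
        rw [AddSubgroup.torsionBy.nsmul_iff]
        exact congrArg (fun z : B ↦ (z : M)) hb
      · intro a b hab
        apply Subtype.ext; apply Subtype.ext
        exact congrArg (fun z : ↥(AddSubgroup.torsionBy M ((p ^ n : ℕ) : ℤ)) ↦ (z : M)) hab
    · rw [AddSubgroup.torsionBy.nsmul_iff] at hb ⊢
      rw [← map_nsmul, hb, map_zero]
  -- admissible `p`-th roots and their Kummer classes in `H¹(H, M[p])`
  let incl := (AddSubgroup.torsionBy M (p : ℤ)).subtype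
  have hmemB : ∀ (b : M), (∀ σ : H, σ • (p • b) = p • b) →
      ∀ σ : H, (σ • b - b : M) ∈ AddSubgroup.torsionBy M (p : ℤ) := by
    intro b hb σ
    refine AddSubgroup.torsionBy.nsmul_iff.mpr ?_
    rw [smul_sub, smul_comm, hb σ, sub_self]
  let coc : ∀ (b : M), (∀ σ : H, σ • (p • b) = p • b) →
      contOneCocycles (discreteTopRep H ↥(AddSubgroup.torsionBy M (p : ℤ))) := fun b hb ↦
    contOneCocycles.lift incl (fun _ _ ↦ rfl) (fun _ _ h ↦ Subtype.ext h)
      (cobCocycle b (hcont b)) (fun σ ↦ ⟨_, hmemB b hb σ⟩) (fun _ ↦ rfl)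
  have hcoc : ∀ b hb (σ : H), (((coc b hb).1 σ : ↥(AddSubgroup.torsionBy M (p : ℤ))) : M) =
      σ • b - b := fun _ _ _ ↦ rfl
  -- two admissible roots differing by `B + M[p]` give the same class
  have hcls : ∀ (b₁ b₂ : M) (hb₁ : ∀ σ : H, σ • (p • b₁) = p • b₁)
      (hb₂ : ∀ σ : H, σ • (p • b₂) = p • b₂) (β : M),
      (∀ σ : H, σ • β = β) → p • (b₁ - b₂ - β) = 0 →
      oneCocycleClass _ (coc b₁ hb₁) = oneCocycleClass _ (coc b₂ hb₂) := by
    intro b₁ b₂ hb₁ hb₂ β hβ hpe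
    have he : (b₁ - b₂ - β : M) ∈ AddSubgroup.torsionBy M (p : ℤ) :=
      AddSubgroup.torsionBy.nsmul_iff.mpr hpe
    rw [← sub_eq_zero, ← oneCocycleClass_sub, oneCocycleClass_eq_zero_iff]
    refine ⟨⟨_, he⟩, fun σ ↦ ?_⟩
    apply Subtype.ext
    change (((coc b₁ hb₁).1 σ - (coc b₂ hb₂).1 σ : ↥(AddSubgroup.torsionBy M (p : ℤ))) : M) = _
    rw [AddSubgroupClass.coe_sub, hcoc b₁ hb₁, hcoc b₂ hb₂]
    change _ = (σ • (b₁ - b₂ - β) - (b₁ - b₂ - β) : M)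
    rw [smul_sub, smul_sub, hβ]
    abel
  -- every kernel element is the class of an admissible root
  have hker : ∀ x ∈ (resH1Hom (ContinuousMonoidHom.id H) incl (fun _ _ ↦ rfl) :
      subgroupH1 H ↥(AddSubgroup.torsionBy M (p : ℤ)) →+ subgroupH1 H M).ker,
      ∃ b hb, x = oneCocycleClass _ (coc b hb) := by
    intro x hx
    obtain ⟨φ, rfl⟩ := oneCocycleClass_surjective _ x
    rw [AddMonoidHom.mem_ker, resH1Hom_id_oneCocycleClass, oneCocycleClass_eq_zero_iff] at hx
    obtain ⟨b, hb⟩ := hx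
    have hb' : ∀ σ : H, incl (φ.1 σ) = σ • b - b := fun σ ↦ hb σ
    have hadm : ∀ σ : H, σ • (p • b) = p • b := fun σ ↦ by
      have h1 : p • (σ • b - b) = 0 := by
        rw [← hb' σ, ← map_nsmul]
        have : p • φ.1 σ = 0 := Subtype.ext (by
          rw [AddSubgroupClass.coe_nsmul, ZeroMemClass.coe_zero]
          exact AddSubgroup.torsionBy.nsmul_iff.mp (φ.1 σ).2)
        rw [this, map_zero]
      rw [smul_sub, smul_comm, sub_eq_zero] at h1
      exact h1
    refine ⟨b, hadm, congrArg _ (Subtype.ext (ContinuousMap.ext fun σ ↦ ?_))⟩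
    apply Subtype.ext
    change (incl (φ.1 σ) : M) = incl ((coc b hadm).1 σ)
    rw [hb' σ]
    rfl
  -- roots of elements of `B`
  have hroot : ∀ β : B, ∃ b : M, p • b = (β : M) := fun β ↦ hdiv _
  choose root hroot using hroot
  have hadm_root : ∀ β : B, ∀ σ : H, σ • (p • root β) = p • root β := fun β σ ↦ by
    rw [hroot]; exact β.2 σ
  let f : B ⧸ mulp.range → subgroupH1 H ↥(AddSubgroup.torsionBy M (p : ℤ)) := fun q ↦
    oneCocycleClass _ (coc (root q.out) (hadm_root q.out))
  refine (Set.finite_range f).subset fun x hx ↦ ?_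
  obtain ⟨b, hb, rfl⟩ := hker x hx
  -- `β = p • b ∈ B`, `q = [β]`; `out q = β + p β'`
  let β : B := ⟨p • b, fun σ ↦ hb σ⟩
  refine ⟨QuotientAddGroup.mk β, ?_⟩
  have hout : ∃ β' : B, ((QuotientAddGroup.mk β : B ⧸ mulp.range)).out = β + p • β' := by
    obtain ⟨⟨_, β', rfl⟩, h⟩ := QuotientAddGroup.mk_out_eq_mul mulp.range β
    exact ⟨β', by rw [h]; rfl⟩
  obtain ⟨β', hβ'⟩ := hout
  show oneCocycleClass _ (coc (root ((QuotientAddGroup.mk β : B ⧸ mulp.range)).out) (hadm_root _)) =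
    oneCocycleClass _ (coc b hb)
  refine hcls _ _ (hadm_root _) hb ((β' : B) : M) (fun σ ↦ β'.2 σ) ?_
  rw [smul_sub, smul_sub, hroot, hβ', AddSubgroup.coe_add, AddSubgroupClass.coe_nsmul]
  change (p • b : M) + p • ((β' : B) : M) - p • b - p • ((β' : B) : M) = 0
  abel

/-! ## §3. Trivial action: `ι` is injective; naturality -/

omit [IsTopologicalGroup G] in
/-- **If `H` acts trivially on `M` then `ι_H : H¹(H, M[p]) → H¹(H, M)` is injective**: a kernel
class is `[φ]` with `φ = ∂b` for some `b ∈ M`, and `∂b = 0`. (Used at an inertia group acting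
trivially on `M`: an `M[p]`-valued class unramified as an `M`-valued class is unramified.)
[cite: SerreGaloisCohomology1997, I §2.2] -/
theorem torsionToH1_injective_of_forall_smul_eq [IsTopologicalGroup G]
    (htriv : ∀ (σ : H) (m : M), σ • m = m) :
    Function.Injective (resH1Hom (ContinuousMonoidHom.id H) (AddSubgroup.torsionBy M (p : ℤ)).subtype
      (fun _ _ ↦ rfl) : subgroupH1 H ↥(AddSubgroup.torsionBy M (p : ℤ)) →+ subgroupH1 H M) := by
  refine (injective_iff_map_eq_zero _).2 fun x hx ↦ ?_
  obtain ⟨φ, rfl⟩ := oneCocycleClass_surjective _ x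
  rw [resH1Hom_id_oneCocycleClass, oneCocycleClass_eq_zero_iff] at hx
  obtain ⟨b, hb⟩ := hx
  have hzero : ∀ σ : H, φ.1 σ = 0 := fun σ ↦ by
    apply Subtype.ext
    have h := hb σ
    change ((φ.1 σ : ↥(AddSubgroup.torsionBy M (p : ℤ))) : M) = σ • b - b at h
    rw [h, htriv, sub_self, ZeroMemClass.coe_zero]
  have hφ : φ = 0 := Subtype.ext (ContinuousMap.ext fun σ ↦ by rw [hzero]; rfl)
  rw [hφ]
  exact (oneCocycleClassₗ _).map_zero

variable {H} in
/-- Naturality: `conj_σ ∘ ι_H = ι_H ∘ conj_σ` on `H¹(H, ·)` for `H ⊴ G` (`resH1Hom_comp`; the tree's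
`conjH1_torsionToPrimaryH1Sub`). [cite: NeukirchSchmidtWingberg2008, I §5] -/
theorem conjH1_torsionToH1 [H.Normal] (σ : G) (y : subgroupH1 H ↥(AddSubgroup.torsionBy M (p : ℤ))) :
    conjH1 H M σ (resH1Hom (ContinuousMonoidHom.id H) (AddSubgroup.torsionBy M (p : ℤ)).subtype
      (fun _ _ ↦ rfl) y) =
      resH1Hom (ContinuousMonoidHom.id H) (AddSubgroup.torsionBy M (p : ℤ)).subtype (fun _ _ ↦ rfl)
        (conjH1 H ↥(AddSubgroup.torsionBy M (p : ℤ)) σ y) := by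
  change ((conjH1 H M σ).comp (resH1Hom (ContinuousMonoidHom.id H)
      (AddSubgroup.torsionBy M (p : ℤ)).subtype (fun _ _ ↦ rfl))) y =
    ((resH1Hom (ContinuousMonoidHom.id H) (AddSubgroup.torsionBy M (p : ℤ)).subtype
      (fun _ _ ↦ rfl)).comp (conjH1 H ↥(AddSubgroup.torsionBy M (p : ℤ)) σ)) y
  rw [conjH1, conjH1, resH1Hom_comp, resH1Hom_comp]
  exact congrArg (fun f : subgroupH1 H ↥(AddSubgroup.torsionBy M (p : ℤ)) →+ subgroupH1 H M ↦ f y)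
    (resH1Hom_congr (ContinuousMonoidHom.ext fun _ ↦ rfl) (AddMonoidHom.ext fun _ ↦ rfl) _ _)

end Summit.BirchSwinnertonDyer.BirchSwinnertonDyer.Theorems.PrintCf2.KummerTorsion

end
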